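import Summits.FinalStateConjecture.FinalStateConjecture.Theses.ZeroEnergyKerrOrBomb
import Summits.FinalStateConjecture.FinalStateConjecture.Theorems.ZeroEnergyKerrOrBombErgoregionBombModTLightPointSplit

/-!
# Crux `ErgoregionBombModT` (stmt-FinalStateConjecture-17838) — skeleton `killing-light-points`, reshape c2 (v4)

Custody: line lead c4 (`prover-line-stmt-FinalStateConjecture-17838-c4-0`, 2026-08-17T05:45Z) — shape v4
kept UNCHANGED (terminal lossless split; both registered stubs crux-sized, standing `promote-stub`); c3
before.  Cycle-4 bricks (algebraic speciality of B's evanescent species; `□ g(T,T) ≥ 0` at vacuum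
hovering light points) land Theses-free under `Theorems/ZeroEnergyKerrOrBombErgoregionBombModT*.lean
--supports` as registered certificates.

Lead prover's skeleton (line lead `prover-line-stmt-FinalStateConjecture-17838-c2-0`, 2026-08-17), fourth
and TERMINAL shape of the line built from ideator 2's crux idea card `Ideas/killing-light-points.md`:
the LOSSLESS split of the crux into its two necessary-and-sufficient halves, kernel-checked and landed
as `Theorems/ZeroEnergyKerrOrBombErgoregionBombModTLightPointSplit.lean`
(`ergoregionBombModT_iff_offWall_and_lightPointBomb`).

History.  Shape 1 (lead 0): `crux ⇐ stub_offWallBomb ∧ stub_noDocLightPoints` (p135563).  Shape 2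
(lead c1): `NoDocLightPoints` split into four species × position stubs, collar × incomplete CLOSED
(p136504).  Shape 3 (lead c2, cycle 2): hovering stubs merged (W23).  Cycle 2 then showed that every
Killing light point of the d.o.c. INHABITS the crux's antecedent (hovering: complete null geodesic
orbit, p138761; incomplete `κ ≠ 0`: the logarithmic reparametrisation of the orbit is a maximal
zero-energy null geodesic on a half-line — its would-be endpoint is a zero of `T` on `𝓔⁺ ⊆ U`, excluded
by the collar lemma of p136504 — `…LightPointAntecedent.lean`), so the W-stubs ("no light point in the
d.o.c.") are sufficient but NOT necessary: they are a smooth-uniqueness-type statement (Hájíček 1973 /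
Hawking–Ellis §9.3 p. 331: the stationary limit surface of a vacuum hole CONTAINS null geodesic
`T`-orbits, hidden on the horizon in Kerr), free on the rigidity side
(`noDocLightPoints_of_nonTrapping`) and foreign to the bomb side.  Registered stubs of shape 4:

* `stub_offWallBomb` (A) — the crux restricted to trapped zero-energy rays entering `{g(T,T) > 0}`
  (extra antecedent clause `∃ t ∈ s, 0 < g(T,T)(γ t)`); NECESSARY; CRUX-SIZED (the off-wall Friedman
  race next to a rotating horizon; no mechanism in print).
* `stub_lightPointBomb` (B) — the crux restricted to Killing light points: `p ∈ ⟨⟨M_ext⟩⟩`,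
  `g(T,T)(p) = 0`, `∇_T T = κ T` at `p` (any `κ`) ⇒ the growing Killing-mode pair; NECESSARY
  (`lightPointBomb_of_ergoregionBombModT`); CRUX-SIZED (a mode from a light line alone; nearest
  prints — evanescent ergosurfaces, Keir arXiv:1810.03026 — give log decay and NO growing mode in the
  horizonless non-vacuum analogue).  Sufficient routes to B that do not build a mode: W1 ∧ W23 of
  shape 3 (absence of light points; global, rigidity-type) via `noDocLightPoints_of_belt_of_hovering`.

Both stubs being crux-sized, the line has no further internal move: `promote-stub` for A and B (or
restate the crux as A with B filed separately; adding `s = Set.univ` deletes only the incomplete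
species of B).  `lean check`: sorries only in the two `stub_*`; `ErgoregionBombModT_of` concludes the
crux BY NAME.
-/

noncomputable section

open Bundle Set Filter Function
open scoped Manifold Topology

set_option linter.dupNamespace false

namespace Summit.FinalStateConjecture.FinalStateConjecture.Cruxes.ErgoregionBombModT.KillingLightPoints

open Literature.Geometry.Lorentzian

/-! ## Registered stubs (D-0027 §3.3 pattern: `Holds.stub_*` + by-name handles) -/

namespace Holds

/-- **Stub A (off-wall bomb; NECESSARY, CRUX-SIZED).** `ErgoregionBombModT` restricted to trapped
zero-energy null geodesics which enter the open ergoregion `{g(T,T) > 0}` at some parameter (extra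
clause after the trapping clause).  No mechanism for it is claimed here. -/
theorem stub_offWallBomb :
    ∀ (𝓑 : Literature.Geometry.Lorentzian.StationaryAFBlackHole.{0}) [𝓑.metric.HasLeviCivita] [Literature.Geometry.Lorentzian.Kerr.Facts], 𝓑.metric.toPseudoRiemannianMetric.IsRicciFlat → 𝓑.IsIPlusRegular → (∀ p : 𝓑.carrier, p ∈ 𝓑.metric.chronologicalFuture 𝓑.timeOrientation 𝓑.Mext) → (∀ p ∈ 𝓑.doc, 𝓑.killing p ≠ 0) → SimplyConnectedSpace 𝓑.doc → ∀ (U : Set 𝓑.carrier) (K : Π x : 𝓑.carrier, TangentSpace (𝓡 4) x), IsOpen U → 𝓑.horizon ⊆ U → IsConnected 𝓑.horizon → ContMDiffOn (𝓡 4) ((𝓡 4).prod 𝓘(ℝ, Literature.Geometry.Lorentzian.E4)) ((⊤ : ℕ∞) : WithTop ℕ∞) (fun x ↦ (Bundle.TotalSpace.mk' Literature.Geometry.Lorentzian.E4 x (K x) : TangentBundle (𝓡 4) 𝓑.carrier)) U → (∀ x ∈ U, ∀ v w : TangentSpace (𝓡 4) x, 𝓑.metric.val x (𝓑.metric.leviCivita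 K x v) w + 𝓑.metric.val x v (𝓑.metric.leviCivita K x w) = 0) → (∀ x ∈ U, VectorField.mlieBracket (𝓡 4) 𝓑.killing K x = 0) → (∀ p ∈ 𝓑.horizon, K p ≠ 0) → (∀ γ : ℝ → 𝓑.carrier, IsMIntegralCurve γ K → γ 0 ∈ 𝓑.horizon → ∀ t, γ t ∈ 𝓑.horizon) → (∀ x ∈ U ∩ 𝓑.doc, 𝓑.metric.val x (K x) (K x) < 0) → (∃ S₀ : Set 𝓑.carrier, IsCompact S₀ ∧ S₀ ⊆ 𝓑.doc ∧ ∀ y ∈ 𝓑.doc, 0 ≤ 𝓑.metric.val y (𝓑.killing y) (𝓑.killing y) → y ∉ U → y ∈ Literature.Geometry.Lorentzian.stationaryOrbit 𝓑.killing S₀) → ∀ S : Set 𝓑.carrier, IsCompact S → S ⊆ 𝓑.doc → ∀ (γ : ℝ → 𝓑.carrier) (s : Set ℝ), Literature.Geometry.Lorentzian.IsMaximalGeodesicOn 𝓑.metric.toPseudoRiemannianMetric.leviCivita γ s → s.Nonempty → (∀ t ∈ s, 𝓑.metric.val (γ t) (Literature.Geometry.Lorentzian.velocity (𝓡 4) γ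 t) (Literature.Geometry.Lorentzian.velocity (𝓡 4) γ t) = 0 ∧ Literature.Geometry.Lorentzian.velocity (𝓡 4) γ t ≠ 0 ∧ 𝓑.metric.val (γ t) (Literature.Geometry.Lorentzian.velocity (𝓡 4) γ t) (𝓑.killing (γ t)) = 0) → (∀ t ∈ s, γ t ∈ Literature.Geometry.Lorentzian.stationaryOrbit 𝓑.killing S) → (∃ t ∈ s, 0 < 𝓑.metric.val (γ t) (𝓑.killing (γ t)) (𝓑.killing (γ t))) → ∃ (ν ω : ℝ) (ψ χ : 𝓑.carrier → ℝ), 0 < ν ∧ (∃ U : Set 𝓑.carrier, IsOpen U ∧ 𝓑.doc ∪ 𝓑.horizon ⊆ U ∧ ContMDiffOn (𝓡 4) 𝓘(ℝ, ℝ) ((⊤ : ℕ∞) : WithTop ℕ∞) ψ U ∧ ContMDiffOn (𝓡 4) 𝓘(ℝ, ℝ) ((⊤ : ℕ∞) : WithTop ℕ∞) χ U) ∧ (∀ x ∈ 𝓑.doc, 𝓑.metric.dalembertian ψ x = 0 ∧ 𝓑.metric.dalembertian χ x = 0) ∧ (∀ x ∈ 𝓑.doc, mfderiv (𝓡 4)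 𝓘(ℝ, ℝ) ψ x (𝓑.killing x) = ν * ψ x - ω * χ x ∧ mfderiv (𝓡 4) 𝓘(ℝ, ℝ) χ x (𝓑.killing x) = ω * ψ x + ν * χ x) ∧ (∃ C : ℝ, ∀ x ∈ 𝓑.doc ∩ 𝓑.metric.chronologicalPast 𝓑.timeOrientation (𝓑.embed '' 𝓑.e.far (𝓑.e.R + 1)), |ψ x| ≤ C ∧ |χ x| ≤ C) ∧ ∃ x ∈ 𝓑.doc, ψ x ≠ 0 ∨ χ x ≠ 0 := by
  sorry

/-- **Stub B (light-point bomb; NECESSARY, CRUX-SIZED).** `ErgoregionBombModT` restricted to Killing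
light points: in the telescope, a point `p ∈ ⟨⟨M_ext⟩⟩` with `g(T,T)(p) = 0` and `∇_T T = κ T` (any
`κ`; its orbit, reparametrised, is a maximal zero-energy null geodesic trapped modulo the flow)
forces the growing Killing-mode pair.  No mechanism for it is claimed here. -/
theorem stub_lightPointBomb :
    ∀ (𝓑 : Literature.Geometry.Lorentzian.StationaryAFBlackHole.{0}) [𝓑.metric.HasLeviCivita] [Literature.Geometry.Lorentzian.Kerr.Facts], 𝓑.metric.toPseudoRiemannianMetric.IsRicciFlat → 𝓑.IsIPlusRegular → (∀ p : 𝓑.carrier, p ∈ 𝓑.metric.chronologicalFuture 𝓑.timeOrientation 𝓑.Mext) → (∀ p ∈ 𝓑.doc, 𝓑.killing p ≠ 0) → SimplyConnectedSpace 𝓑.doc → ∀ (U : Set 𝓑.carrier) (K : Π x : 𝓑.carrier, TangentSpace (𝓡 4) x), IsOpen U → 𝓑.horizon ⊆ U → IsConnected 𝓑.horizon → ContMDiffOn (𝓡 4) ((𝓡 4).prod 𝓘(ℝ, Literature.Geometry.Lorentzian.E4)) ((⊤ : ℕ∞) : WithTop ℕ∞) (fun x ↦ (Bundle.TotalSpace.mk'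 Literature.Geometry.Lorentzian.E4 x (K x) : TangentBundle (𝓡 4) 𝓑.carrier)) U → (∀ x ∈ U, ∀ v w : TangentSpace (𝓡 4) x, 𝓑.metric.val x (𝓑.metric.leviCivita K x v) w + 𝓑.metric.val x v (𝓑.metric.leviCivita K x w) = 0) → (∀ x ∈ U, VectorField.mlieBracket (𝓡 4) 𝓑.killing K x = 0) → (∀ p ∈ 𝓑.horizon, K p ≠ 0) → (∀ γ : ℝ → 𝓑.carrier, IsMIntegralCurve γ K → γ 0 ∈ 𝓑.horizon → ∀ t, γ t ∈ 𝓑.horizon) → (∀ x ∈ U ∩ 𝓑.doc, 𝓑.metric.val x (K x) (K x) < 0) → (∃ S₀ : Set 𝓑.carrier, IsCompact S₀ ∧ S₀ ⊆ 𝓑.doc ∧ ∀ y ∈ 𝓑.doc, 0 ≤ 𝓑.metric.val y (𝓑.killing y) (𝓑.killing y) → y ∉ U → y ∈ Literature.Geometry.Lorentzian.stationaryOrbit 𝓑.killing S₀) → ∀ p ∈ 𝓑.doc, 𝓑.metric.val p (𝓑.killing p) (𝓑.killing p) = 0 → ∀ κ : ℝ, 𝓑.metric.leviCivita 𝓑.killing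 p (𝓑.killing p) = κ • 𝓑.killing p → ∃ (ν ω : ℝ) (ψ χ : 𝓑.carrier → ℝ), 0 < ν ∧ (∃ U : Set 𝓑.carrier, IsOpen U ∧ 𝓑.doc ∪ 𝓑.horizon ⊆ U ∧ ContMDiffOn (𝓡 4) 𝓘(ℝ, ℝ) ((⊤ : ℕ∞) : WithTop ℕ∞) ψ U ∧ ContMDiffOn (𝓡 4) 𝓘(ℝ, ℝ) ((⊤ : ℕ∞) : WithTop ℕ∞) χ U) ∧ (∀ x ∈ 𝓑.doc, 𝓑.metric.dalembertian ψ x = 0 ∧ 𝓑.metric.dalembertian χ x = 0) ∧ (∀ x ∈ 𝓑.doc, mfderiv (𝓡 4) 𝓘(ℝ, ℝ) ψ x (𝓑.killing x) = ν * ψ x - ω * χ x ∧ mfderiv (𝓡 4) 𝓘(ℝ, ℝ) χ x (𝓑.killing x) = ω * ψ x + ν * χ x) ∧ (∃ C : ℝ, ∀ x ∈ 𝓑.doc ∩ 𝓑.metric.chronologicalPast 𝓑.timeOrientation (𝓑.embed '' 𝓑.e.far (𝓑.e.R + 1)), |ψ x| ≤ C ∧ |χ x| ≤ C) ∧ ∃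 x ∈ 𝓑.doc, ψ x ≠ 0 ∨ χ x ≠ 0 := by
  sorry

end Holds

/-- Statement of registered stub A (`Holds.stub_offWallBomb`), by name. -/
def stub_offWallBomb : Prop := type_of% Holds.stub_offWallBomb

/-- Statement of registered stub B (`Holds.stub_lightPointBomb`), by name. -/
def stub_lightPointBomb : Prop := type_of% Holds.stub_lightPointBomb

/-! ## Composition -/

/-- **`ErgoregionBombModT ⇐ stub_offWallBomb ∧ stub_lightPointBomb`** (concludes the crux BY NAME):
the landed joint-sufficiency half `ergoregionBombModT_of_offWall_of_lightPointBomb` of the lossless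
split (`Theorems/ZeroEnergyKerrOrBombErgoregionBombModTLightPointSplit.lean`). -/
theorem ErgoregionBombModT_of (hOff : stub_offWallBomb) (hLP : stub_lightPointBomb) :
    Summit.FinalStateConjecture.FinalStateConjecture.Theses.ZeroEnergyKerrOrBomb.ErgoregionBombModT :=
  Summit.FinalStateConjecture.FinalStateConjecture.Theorems.ErgoregionBombModT.ergoregionBombModT_of_offWall_of_lightPointBomb
    hOff hLP

/-- **The split is lossless**: conversely the crux gives back both stubs (so nothing weaker than
the crux closes this skeleton, and nothing stronger is asked). -/
theorem stubs_of_ErgoregionBombModT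
    (h : Summit.FinalStateConjecture.FinalStateConjecture.Theses.ZeroEnergyKerrOrBomb.ErgoregionBombModT) :
    stub_offWallBomb ∧ stub_lightPointBomb :=
  Summit.FinalStateConjecture.FinalStateConjecture.Theorems.ErgoregionBombModT.ergoregionBombModT_iff_offWall_and_lightPointBomb.1
    h

/-- D-0027 §3.3: the crux from the registered stubs themselves (an `example`, so that
`ErgoregionBombModT_of` stays the unique theorem concluding the crux; it becomes a proof once the
two `sorry`s are discharged). -/
example : Summit.FinalStateConjecture.FinalStateConjecture.Theses.ZeroEnergyKerrOrBomb.ErgoregionBombModT :=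
  ErgoregionBombModT_of Holds.stub_offWallBomb Holds.stub_lightPointBomb

end Summit.FinalStateConjecture.FinalStateConjecture.Cruxes.ErgoregionBombModT.KillingLightPoints

end
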